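import Summits.Ventures.PercRepro.RLSRuleProfile
import Summits.Ventures.PercRepro.RLSRuleBigReduction

/-!
# C-025 at q = 3: on the core every plane has at most `6` points, and a `6`-point plane avoids every point by a line
(night-3, gen 4; mine-4's structural reading of 08:56Z made kernel)

From the `e`-free partition clause of `Core` (`E ∖ {e} = A ⊔ A′` with `e ∉ cl(A)`, `e ∉ cl(A′)`) for a point `e` of a
plane `G`: `A ∩ G` and `A′ ∩ G` have rank `≤ 2` (a rank-`3` part would close to `G ∋ e`), hence `≤ 3` points each
(no `4`-point line on the core):

* `exists_partition_of_core` — the two parts of `G ∖ {e}`, with rank `≤ 2`;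
* **`card_le_seven_of_core`**, **`card_le_six_of_core`** — `|G| ≤ 7`, and `|G| = 7` is impossible (the two parts would
  be disjoint `3`-point lines covering `G ∖ {e}`; moving `e` to a point `e′` of the first line, the three points
  `e, u, v` of `{e} ∪ (L₁ ∖ {e′})` cannot be covered by two lines avoiding `e′`);
* **`exists_line_avoiding_of_six`** — on a `6`-point plane every point `e` lies outside some `3`-point line of `G`
  (the parts have sizes `3 + 2`: the `3`-point part is a line avoiding `e`).
Hence `R3PlusPerFlatBig p` is exactly the Prop on the `6`-point planes (`R3PlusPerFlatBig_of_six`).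
Imports `RLSRuleProfile`, `RLSRuleBigReduction`.  Axioms: standard.
-/

open scoped Matroid

namespace PercRepro

namespace NightThree

open Finset ThmH PerFlat

variable {α : Type*} [DecidableEq α] {M : Matroid α} [M.Finite]

/-- A subset of a plane of the core of rank `≤ 2` with `3` points is a dependent triple; with `2` points it is
contained in the closure of its two points; in every case a rank-`≤ 2` subset of `G` that contains two points `u ≠ v`
lies in `cl{u, v} ∩ G`, and so does every `3`-point line through `u, v`. -/
theorem subset_closure_pair_of_eRk_le_two {G B : Finset α} (hG : G ∈ flatsQ M 3) (hB : B ⊆ G)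
    (hr : M.eRk (B : Set α) ≤ 2) {u v : α} (hu : u ∈ B) (hv : v ∈ B) (huv : u ≠ v) {p : ℕ} (hc : Core M p) :
    (B : Set α) ⊆ M.closure (({u, v} : Finset α) : Set α) := by
  have hGE : G ⊆ gr M := (mem_flatsQ.1 hG).1
  have hBE : (B : Set α) ⊆ M.E := by rw [← coe_gr M]; exact Finset.coe_subset.2 (hB.trans hGE)
  have hPr : M.eRk (({u, v} : Finset α) : Set α) = 2 := by
    rw [Finset.coe_pair]
    exact hc.1 u (hBE (Finset.mem_coe.2 hu)) v (hBE (Finset.mem_coe.2 hv)) huv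
  have hPB : ({u, v} : Finset α) ⊆ B := by
    intro x hx; rw [Finset.mem_insert, Finset.mem_singleton] at hx
    rcases hx with rfl | rfl
    · exact hu
    · exact hv
  have hcl : M.closure (({u, v} : Finset α) : Set α) = M.closure (B : Set α) :=
    closure_eq_of_subset_flat (M.isFlat_closure _)
      ((Finset.coe_subset.2 hPB).trans (M.subset_closure _ hBE)) (Finset.finite_toSet _)
      (by rw [M.eRk_closure_eq, hPr]; exact hr)
  rw [hcl]
  exact M.subset_closure _ hBE

/-- **The partition of `G ∖ {e}` on the core.**  For a plane `G` and `e ∈ G` there are `A₁, A₂ ⊆ G ∖ {e}`, disjoint,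
covering `G ∖ {e}`, of rank `≤ 2`, with `e ∉ cl(A₁)` and `e ∉ cl(A₂)`. -/
theorem exists_partition_of_core {p : ℕ} (hc : Core M p) {G : Finset α} (hG : G ∈ flatsQ M 3) {e : α}
    (he : e ∈ G) :
    ∃ A₁ A₂ : Finset α, A₁ ⊆ G.erase e ∧ A₂ ⊆ G.erase e ∧ Disjoint A₁ A₂ ∧ A₁ ∪ A₂ = G.erase e ∧
      M.eRk (A₁ : Set α) ≤ 2 ∧ M.eRk (A₂ : Set α) ≤ 2 ∧
      e ∉ M.closure (A₁ : Set α) ∧ e ∉ M.closure (A₂ : Set α) := by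
  classical
  have hGE : G ⊆ gr M := (mem_flatsQ.1 hG).1
  have heE : e ∈ M.E := by rw [← coe_gr M]; exact Finset.mem_coe.2 (hGE he)
  obtain ⟨A, hAE, heA, heA'⟩ := hc.2.2.2 e heE
  refine ⟨(G.erase e).filter (fun x => x ∈ A), (G.erase e).filter (fun x => x ∉ A), Finset.filter_subset _ _,
    Finset.filter_subset _ _, Finset.disjoint_filter_filter_not _ _ _, Finset.filter_union_filter_not_eq _ _,
    ?_, ?_, ?_, ?_⟩
  · -- rank `≤ 2`: else the part closes to `G ∋ e`
    by_contra hlt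
    push Not at hlt
    have h3 : M.eRk (((G.erase e).filter (fun x => x ∈ A) : Finset α) : Set α) = 3 := by
      apply le_antisymm
      · rw [← eRk_eq_three_of_mem_flatsQ' hG]
        exact M.eRk_mono (Finset.coe_subset.2 ((Finset.filter_subset _ _).trans (Finset.erase_subset _ _)))
      · exact Order.add_one_le_of_lt hlt
    have hcl := closure_eq_of_subset_plane (by rw [← flatsQ_three]; exact hG)
      ((Finset.filter_subset _ _).trans (Finset.erase_subset _ _)) h3
    apply heA
    have hsub : (((G.erase e).filter (fun x => x ∈ A) : Finset α) : Set α) ⊆ A := by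
      intro x hx; exact (Finset.mem_filter.1 (Finset.mem_coe.1 hx)).2
    exact M.closure_mono hsub (by rw [hcl]; exact Finset.mem_coe.2 he)
  · by_contra hlt
    push Not at hlt
    have h3 : M.eRk (((G.erase e).filter (fun x => x ∉ A) : Finset α) : Set α) = 3 := by
      apply le_antisymm
      · rw [← eRk_eq_three_of_mem_flatsQ' hG]
        exact M.eRk_mono (Finset.coe_subset.2 ((Finset.filter_subset _ _).trans (Finset.erase_subset _ _)))
      · exact Order.add_one_le_of_lt hlt
    have hcl := closure_eq_of_subset_plane (by rw [← flatsQ_three]; exact hG)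
      ((Finset.filter_subset _ _).trans (Finset.erase_subset _ _)) h3
    apply heA'
    have hsub : (((G.erase e).filter (fun x => x ∉ A) : Finset α) : Set α) ⊆ (M.E \ {e}) \ A := by
      intro x hx
      have hx' := Finset.mem_filter.1 (Finset.mem_coe.1 hx)
      have hxe := Finset.mem_erase.1 hx'.1
      exact ⟨⟨by rw [← coe_gr M]; exact Finset.mem_coe.2 (hGE hxe.2), fun h => hxe.1 (Set.mem_singleton_iff.1 h)⟩, hx'.2⟩
    exact M.closure_mono hsub (by rw [hcl]; exact Finset.mem_coe.2 he)
  · intro h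
    apply heA
    exact M.closure_mono (fun x hx => (Finset.mem_filter.1 (Finset.mem_coe.1 hx)).2) h
  · intro h
    apply heA'
    exact M.closure_mono (fun x hx => by
      have hx' := Finset.mem_filter.1 (Finset.mem_coe.1 hx)
      have hxe := Finset.mem_erase.1 hx'.1
      exact ⟨⟨by rw [← coe_gr M]; exact Finset.mem_coe.2 (hGE hxe.2), fun h => hxe.1 (Set.mem_singleton_iff.1 h)⟩,
        hx'.2⟩) h

/-- On the core a plane has at most `7` points. -/
theorem card_le_seven_of_core {p : ℕ} (hc : Core M p) {G : Finset α} (hG : G ∈ flatsQ M 3) : G.card ≤ 7 := by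
  obtain ⟨e, he⟩ : ∃ e, e ∈ G :=
    Finset.card_pos.1 (by have := three_le_card_of_eRk_eq_three (eRk_eq_three_of_mem_flatsQ' hG); omega)
  obtain ⟨A₁, A₂, h1, h2, hd, hu, hr1, hr2, _, _⟩ := exists_partition_of_core hc hG he
  have hc1 := card_le_three_of_eRk_le_two_of_core hc hG (h1.trans (Finset.erase_subset _ _)) hr1
  have hc2 := card_le_three_of_eRk_le_two_of_core hc hG (h2.trans (Finset.erase_subset _ _)) hr2
  have := Finset.card_union_of_disjoint hd
  rw [hu, Finset.card_erase_of_mem he] at this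
  omega

/-- **On the core a `6`-point plane avoids every point by a `3`-point line**: for `e ∈ G` there is a dependent
triple `ℓ ⊆ G` with `e ∉ ℓ`. -/
theorem exists_line_avoiding_of_six {p : ℕ} (hc : Core M p) {G : Finset α} (hG : G ∈ flatsQ M 3)
    (hGc : G.card = 6) {e : α} (he : e ∈ G) : ∃ ℓ ∈ depTriples M G, e ∉ ℓ := by
  classical
  obtain ⟨A₁, A₂, h1, h2, hd, hu, hr1, hr2, _, _⟩ := exists_partition_of_core hc hG he
  have hc1 := card_le_three_of_eRk_le_two_of_core hc hG (h1.trans (Finset.erase_subset _ _)) hr1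
  have hc2 := card_le_three_of_eRk_le_two_of_core hc hG (h2.trans (Finset.erase_subset _ _)) hr2
  have hsum := Finset.card_union_of_disjoint hd
  rw [hu, Finset.card_erase_of_mem he, hGc] at hsum
  -- one of the parts has exactly `3` points: a dependent triple avoiding `e`
  have key : ∀ A ⊆ G.erase e, M.eRk (A : Set α) ≤ 2 → A.card = 3 → ∃ ℓ ∈ depTriples M G, e ∉ ℓ := by
    intro A hA hr hAc
    refine ⟨A, ?_, fun h => (Finset.mem_erase.1 (hA h)).1 rfl⟩
    unfold depTriples
    rw [Finset.mem_filter, Finset.mem_powersetCard]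
    refine ⟨⟨hA.trans (Finset.erase_subset _ _), hAc⟩, ?_⟩
    intro hind
    rw [eRk_eq_card_of_indep hind, hAc] at hr
    exact absurd hr (by decide)
  rcases (show A₁.card = 3 ∨ A₂.card = 3 by omega) with h | h
  · exact key A₁ h1 hr1 h
  · exact key A₂ h2 hr2 h

/-- **On the core a plane has at most `6` points.** -/
theorem card_le_six_of_core {p : ℕ} (hc : Core M p) {G : Finset α} (hG : G ∈ flatsQ M 3) : G.card ≤ 6 := by
  classical
  have h7 := card_le_seven_of_core hc hG
  by_contra h
  have hGc : G.card = 7 := by omega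
  have hGE : G ⊆ gr M := (mem_flatsQ.1 hG).1
  obtain ⟨e, he⟩ : ∃ e, e ∈ G := Finset.card_pos.1 (by omega)
  obtain ⟨A₁, A₂, h1, h2, hd, hu, hr1, hr2, he1, he2⟩ := exists_partition_of_core hc hG he
  have hc1 := card_le_three_of_eRk_le_two_of_core hc hG (h1.trans (Finset.erase_subset _ _)) hr1
  have hc2 := card_le_three_of_eRk_le_two_of_core hc hG (h2.trans (Finset.erase_subset _ _)) hr2
  have hsum := Finset.card_union_of_disjoint hd
  rw [hu, Finset.card_erase_of_mem he, hGc] at hsum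
  have hA1 : A₁.card = 3 := by omega
  -- a point `e′ ∈ A₁` and the two other points `u, v` of `A₁`
  obtain ⟨e', he'⟩ : ∃ e', e' ∈ A₁ := Finset.card_pos.1 (by omega)
  obtain ⟨u, v, huv, huv'⟩ : ∃ u v, u ≠ v ∧ A₁.erase e' = {u, v} := by
    have : (A₁.erase e').card = 2 := by rw [Finset.card_erase_of_mem he', hA1]
    obtain ⟨u, v, huv, h⟩ := Finset.card_eq_two.1 this
    exact ⟨u, v, huv, h⟩
  have huA : u ∈ A₁ := (Finset.mem_erase.1 (by rw [huv']; simp)).2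
  have hvA : v ∈ A₁ := (Finset.mem_erase.1 (by rw [huv']; simp)).2
  have hue' : u ≠ e' := (Finset.mem_erase.1 (by rw [huv']; simp)).1
  have hve' : v ≠ e' := (Finset.mem_erase.1 (by rw [huv']; simp)).1
  have he'G : e' ∈ G := (Finset.mem_erase.1 (h1 he')).2
  have hee' : e ≠ e' := fun h => (Finset.mem_erase.1 (h1 he')).1 h.symm
  have heu : e ≠ u := fun h => (Finset.mem_erase.1 (h1 huA)).1 h.symm
  have hev : e ≠ v := fun h => (Finset.mem_erase.1 (h1 hvA)).1 h.symm
  -- `A₁ = cl{u, v} ∩ G` is the whole line through `u, v` inside `G`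
  have hA1cl : (A₁ : Set α) ⊆ M.closure (({u, v} : Finset α) : Set α) :=
    subset_closure_pair_of_eRk_le_two hG (h1.trans (Finset.erase_subset _ _)) hr1 huA hvA huv hc
  -- `e ∉ cl{u, v}` (else `e ∈ cl(A₁)`)
  have hecl : e ∉ M.closure (({u, v} : Finset α) : Set α) := by
    intro h
    apply he1
    have hsub : (({u, v} : Finset α) : Set α) ⊆ (A₁ : Set α) := by
      intro x hx
      rw [Finset.coe_insert, Finset.coe_singleton] at hx
      rcases hx with rfl | rfl
      · exact Finset.mem_coe.2 huA
      · exact Finset.mem_coe.2 hvA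
    exact M.closure_mono hsub h
  -- the partition at `e′`
  obtain ⟨B₁, B₂, hb1, hb2, hbd, hbu, hbr1, hbr2, he'1, he'2⟩ := exists_partition_of_core hc hG he'G
  have hbc1 := card_le_three_of_eRk_le_two_of_core hc hG (hb1.trans (Finset.erase_subset _ _)) hbr1
  have hbc2 := card_le_three_of_eRk_le_two_of_core hc hG (hb2.trans (Finset.erase_subset _ _)) hbr2
  have hbsum := Finset.card_union_of_disjoint hbd
  rw [hbu, Finset.card_erase_of_mem he'G, hGc] at hbsum
  -- where do `e, u, v` go?  `u, v` cannot share a part `B`: `e′ ∈ A₁ ⊆ cl{u, v} ⊆ cl(B)`, but `e′ ∉ cl(B)`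
  have hsep : ∀ B : Finset α, u ∈ B → v ∈ B → e' ∉ M.closure (B : Set α) → False := by
    intro B huB hvB he'B
    apply he'B
    have hsub : (({u, v} : Finset α) : Set α) ⊆ (B : Set α) := by
      intro x hx
      rw [Finset.coe_insert, Finset.coe_singleton] at hx
      rcases hx with rfl | rfl
      · exact Finset.mem_coe.2 huB
      · exact Finset.mem_coe.2 hvB
    exact M.closure_mono hsub (hA1cl (Finset.mem_coe.2 he'))
  have heG' : e ∈ G.erase e' := Finset.mem_erase.2 ⟨hee', he⟩
  have huG' : u ∈ G.erase e' := Finset.mem_erase.2 ⟨hue', (Finset.mem_erase.1 (h1 huA)).2⟩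
  have hvG' : v ∈ G.erase e' := Finset.mem_erase.2 ⟨hve', (Finset.mem_erase.1 (h1 hvA)).2⟩
  -- `e` and `u` (say) share a part `B`; then `v` is in the other part `B′`, whose other points lie in `A₂`
  have hmem : ∀ x ∈ G.erase e', x ∈ B₁ ∨ x ∈ B₂ := by
    intro x hx; rw [← hbu, Finset.mem_union] at hx; exact hx
  -- WLOG by symmetry on the two parts: a general argument for a part containing `v` but not `u`
  have hfinal : ∀ B B' : Finset α, B ⊆ G.erase e' → B' ⊆ G.erase e' → Disjoint B B' → B ∪ B' = G.erase e' →
      M.eRk (B : Set α) ≤ 2 → M.eRk (B' : Set α) ≤ 2 → B.card ≤ 3 → B'.card ≤ 3 → u ∈ B → v ∈ B' → False := by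
    intro B B' hB hB' hdisj hun hr hr' hBc hB'c huB hvB'
    -- `e ∈ B` or `e ∈ B′`
    have hcard := Finset.card_union_of_disjoint hdisj
    rw [hun, Finset.card_erase_of_mem he'G, hGc] at hcard
    have hB3 : B.card = 3 := by omega
    have hB'3 : B'.card = 3 := by omega
    -- `B′ ∖ {v}` has two points, both in `A₂` (not `e`, not `u`, not in `A₁`)... we show `B′ ⊆ cl` of two `A₂`-points
    -- First: `e ∉ B′` or `e ∈ B′`.
    by_cases heB' : e ∈ B'
    · -- `B′ ⊇ {e, v}`: `B′ ⊆ cl{e, v}`; its third point `w` is in `A₂` (not `u`: `u ∈ B`); then `A₂ ∪ {e, v} ⊆ cl{v, w}`?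
      -- simpler: `B = {u} ∪ (two points of A₂)` has rank ≤ 2, so `B ⊆ cl` of those two `A₂`-points `⊆ cl(A₂) ∌ e`, and
      -- `u ∈ cl(A₂)`... we derive `A₂ ∪ {u}` of rank ≤ 2 with `4` points: a long line.
      have hBsub : ∀ x ∈ B, x ≠ u → x ∈ A₂ := by
        intro x hx hxu
        have hxG := hB hx
        have hxne : x ≠ e := fun h => (Finset.disjoint_left.1 hdisj hx) (h ▸ heB')
        have hxnv : x ≠ v := fun h => (Finset.disjoint_left.1 hdisj hx) (h ▸ hvB')
        have : x ∈ A₁ ∪ A₂ := by rw [hu]; exact Finset.mem_erase.2 ⟨hxne, (Finset.mem_erase.1 hxG).2⟩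
        rcases Finset.mem_union.1 this with hA | hA
        · exfalso
          have : x ∈ A₁.erase e' := Finset.mem_erase.2 ⟨(Finset.mem_erase.1 hxG).1, hA⟩
          rw [huv', Finset.mem_insert, Finset.mem_singleton] at this
          rcases this with h | h
          · exact hxu h
          · exact hxnv h
        · exact hA
      obtain ⟨w, w', hww', hB'⟩ : ∃ w w', w ≠ w' ∧ B.erase u = {w, w'} := by
        have : (B.erase u).card = 2 := by rw [Finset.card_erase_of_mem huB, hB3]
        exact Finset.card_eq_two.1 this
      have hwB : w ∈ B := (Finset.mem_erase.1 (by rw [hB']; simp)).2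
      have hw'B : w' ∈ B := (Finset.mem_erase.1 (by rw [hB']; simp)).2
      have hwA : w ∈ A₂ := hBsub w hwB (Finset.mem_erase.1 (by rw [hB']; simp)).1
      have hw'A : w' ∈ A₂ := hBsub w' hw'B (Finset.mem_erase.1 (by rw [hB']; simp)).1
      have hBcl := subset_closure_pair_of_eRk_le_two hG (hB.trans (Finset.erase_subset _ _)) hr hwB hw'B hww' hc
      have hA2cl := subset_closure_pair_of_eRk_le_two hG (h2.trans (Finset.erase_subset _ _)) hr2 hwA hw'A hww' hc
      -- `insert u A₂` has rank `≤ 2` and `4` points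
      have hA2c : A₂.card = 3 := by omega
      have huA2 : u ∉ A₂ := fun h => Finset.disjoint_left.1 hd huA h
      have hins : insert u A₂ ⊆ G := Finset.insert_subset ((Finset.mem_erase.1 (h1 huA)).2) (h2.trans (Finset.erase_subset _ _))
      have hinsr : M.eRk ((insert u A₂ : Finset α) : Set α) ≤ 2 := by
        have hsub : ((insert u A₂ : Finset α) : Set α) ⊆ M.closure (({w, w'} : Finset α) : Set α) := by
          rw [Finset.coe_insert]
          exact Set.insert_subset (hBcl (Finset.mem_coe.2 huB)) hA2cl
        have := M.eRk_mono hsub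
        rw [M.eRk_closure_eq] at this
        refine this.trans ?_
        have := M.eRk_le_encard (({w, w'} : Finset α) : Set α)
        rw [Set.encard_coe_eq_coe_finsetCard, Finset.card_pair hww'] at this
        exact this
      have := card_le_three_of_eRk_le_two_of_core hc hG hins hinsr
      rw [Finset.card_insert_of_notMem huA2, hA2c] at this
      omega
    · -- `e ∈ B` with `u`: `B ⊆ cl{e, u}`; `B′ = {v} ∪ (two points of A₂)`, so `insert v A₂` has rank `≤ 2`, `4` points
      have heB : e ∈ B := by
        rcases hmem e heG' with h | h
        · rw [← hun] at heG'
          rcases Finset.mem_union.1 heG' with h' | h'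
          · exact h'
          · exact absurd h' heB'
        · rw [← hun] at heG'
          rcases Finset.mem_union.1 heG' with h' | h'
          · exact h'
          · exact absurd h' heB'
      have hB'sub : ∀ x ∈ B', x ≠ v → x ∈ A₂ := by
        intro x hx hxv
        have hxG := hB' hx
        have hxne : x ≠ e := fun h => (Finset.disjoint_left.1 hdisj heB) (h ▸ hx)
        have hxnu : x ≠ u := fun h => (Finset.disjoint_left.1 hdisj huB) (h ▸ hx)
        have : x ∈ A₁ ∪ A₂ := by rw [hu]; exact Finset.mem_erase.2 ⟨hxne, (Finset.mem_erase.1 hxG).2⟩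
        rcases Finset.mem_union.1 this with hA | hA
        · exfalso
          have : x ∈ A₁.erase e' := Finset.mem_erase.2 ⟨(Finset.mem_erase.1 hxG).1, hA⟩
          rw [huv', Finset.mem_insert, Finset.mem_singleton] at this
          rcases this with h | h
          · exact hxnu h
          · exact hxv h
        · exact hA
      obtain ⟨w, w', hww', hB''⟩ : ∃ w w', w ≠ w' ∧ B'.erase v = {w, w'} := by
        have : (B'.erase v).card = 2 := by rw [Finset.card_erase_of_mem hvB', hB'3]
        exact Finset.card_eq_two.1 this
      have hwB : w ∈ B' := (Finset.mem_erase.1 (by rw [hB'']; simp)).2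
      have hw'B : w' ∈ B' := (Finset.mem_erase.1 (by rw [hB'']; simp)).2
      have hwA : w ∈ A₂ := hB'sub w hwB (Finset.mem_erase.1 (by rw [hB'']; simp)).1
      have hw'A : w' ∈ A₂ := hB'sub w' hw'B (Finset.mem_erase.1 (by rw [hB'']; simp)).1
      have hBcl := subset_closure_pair_of_eRk_le_two hG (hB'.trans (Finset.erase_subset _ _)) hr' hwB hw'B hww' hc
      have hA2cl := subset_closure_pair_of_eRk_le_two hG (h2.trans (Finset.erase_subset _ _)) hr2 hwA hw'A hww' hc
      have hA2c : A₂.card = 3 := by omega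
      have hvA2 : v ∉ A₂ := fun h => Finset.disjoint_left.1 hd hvA h
      have hins : insert v A₂ ⊆ G := Finset.insert_subset ((Finset.mem_erase.1 (h1 hvA)).2) (h2.trans (Finset.erase_subset _ _))
      have hinsr : M.eRk ((insert v A₂ : Finset α) : Set α) ≤ 2 := by
        have hsub : ((insert v A₂ : Finset α) : Set α) ⊆ M.closure (({w, w'} : Finset α) : Set α) := by
          rw [Finset.coe_insert]
          exact Set.insert_subset (hBcl (Finset.mem_coe.2 hvB')) hA2cl
        have := M.eRk_mono hsub
        rw [M.eRk_closure_eq] at this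
        refine this.trans ?_
        have := M.eRk_le_encard (({w, w'} : Finset α) : Set α)
        rw [Set.encard_coe_eq_coe_finsetCard, Finset.card_pair hww'] at this
        exact this
      have := card_le_three_of_eRk_le_two_of_core hc hG hins hinsr
      rw [Finset.card_insert_of_notMem hvA2, hA2c] at this
      omega
  -- `u` and `v` are in different parts
  rcases hmem u huG' with hu1 | hu2
  · rcases hmem v hvG' with hv1 | hv2
    · exact hsep B₁ hu1 hv1 he'1
    · exact hfinal B₁ B₂ hb1 hb2 hbd hbu hbr1 hbr2 hbc1 hbc2 hu1 hv2
  · rcases hmem v hvG' with hv1 | hv2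
    · exact hfinal B₂ B₁ hb2 hb1 hbd.symm (by rw [Finset.union_comm]; exact hbu) hbr2 hbr1 hbc2 hbc1 hu2 hv1
    · exact hsep B₂ hu2 hv2 he'2

/-- The per-flat Prop of the lane restricted to the `6`-point planes. -/
def R3PlusPerFlatSix (p : ℕ) : Prop :=
  ∀ {β : Type} [DecidableEq β] (M : Matroid β) [M.Finite], Core M p →
    ∀ G ∈ flatsQ M 3, G.card = 6 → phiK p 3 * ((UqG M p 3 G).card : ℚ) ≤ ∑ S ∈ Yq M p 3, wPlus M G S

/-- **The gap is the `6`-point planes**: `R3PlusPerFlatBig p` follows from its restriction to `|G| = 6`. -/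
theorem R3PlusPerFlatBig_of_six {p : ℕ} (hsix : R3PlusPerFlatSix p) : R3PlusPerFlatBig p := by
  intro β hβ M hM hc G hG h6
  have := card_le_six_of_core hc hG
  exact @hsix β hβ M hM hc G hG (by omega)

end NightThree

end PercRepro
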